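import Literature.MathematicalPhysics.QuantumManyBody.StateRelaxationObservable
import Literature.MathematicalPhysics.QuantumLattice.DWaveSourceProofs
import Literature.MathematicalPhysics.QuantumLattice.DWaveSourceNNNHoppingOrderParameter
import HarnessLib

/-!
# One-point certificate rows for the pair-sourced Hubbard torus: `v − ε ≤ 2L²·m_L(h)`

Topic `Literature/MathematicalPhysics/QuantumLattice`. Everything here is PROVED; no definition and
no named fact is introduced. This is the instantiation of the model-free one-point certificate rows
of `QuantumManyBody/StateRelaxationObservable` (`re_groundStateFunctional_ge_of_certificate_kkt`
and its variants) for the Koma–Tasaki pinning-field Hamiltonians of the tree,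

* `A_L(h) = dWaveSourceTorus L U μ h = H(1,U) − μN − h(Δ_d + Δ_d†)` (`DWaveSource`) and its
  `t–t'` twin `dWaveSourceTorusTT' L t' U μ h` (`DWaveSourceNNNHopping`),

with the one-point OBJECTIVE `O = Δ_d + Δ_d†`, whose tracial ground-state expectation is
`Re ω₀(Δ_d + Δ_d†) = 2L²·m_L(h)` in the CONVENTION OF RECORD `m_L(h) = dWaveSourceDensity[TT'] … h
= Re ω₀(Δ_d)/L²` (`re_groundStateFunctional_dWaveSource[TT']_op`; half of Koma–Tasaki's `m`).
A certificate

  `(Δ_d + Δ_d†) − v·1 = gramForm Λ P + (Σₖ (A Xₖ − Xₖ A) + Σₗ (Wₗ Yₗ Wₗᴴ − Yₗ)) + (kktForm A G B + r)`,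

`A = A_L(h)`, with `Λ, G ⪰ 0`, unitaries `Wₗ` commuting with `A` (lattice symmetries of the sourced
torus), ARBITRARY generators `B` — neutral, charged or odd words: `A_L(h)` conserves no particle
number, so the second-order ("KKT", state-optimality) rows `0 ≤ ω₀(Cᴴ (A C − C A))` hold for every
matrix `C` with no chemical-potential licence — and a residual `−ε ≤ Re ω₀(r)` proves

  `v − ε ≤ 2L²·dWaveSourceDensity L U μ h`        (`sq_mul_dWaveSourceDensity_ge_of_certificate_kkt`),

equivalently the per-site response floor `(v − ε)/(2L²) ≤ m_L(h)` (`dWaveSourceDensity_ge_of_certificate_kkt`);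
with energy-window rows `κ₊(Ē·1 − A) + κ₋(A − E̲·1)` fed by certified `E̲ ≤ E₀(A_L(h)) ≤ Ē`
(`…_window`); the CEILING edge `2L²·m_L(h) ≤ v + ε` from `v·1 − (Δ_d + Δ_d†) = …`
(`sq_mul_dWaveSourceDensity_le_of_certificate_kkt`); the `t–t'` twins (`…TT'…`); and the reading for
EVERY symmetric ground-state density matrix `ρ` of `A_L(h)` (`re_trace_dWaveSourceTT'_op_ge_of_certificate_kkt`).

Honest framing (hubbard-cq wording W1): a finite-`h` response floor is a «finite-h response
(certified)» row — symmetry-allowed, NOT an order parameter, NOT a phase word; by the barrier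
`SourcedResponseEpsilonLift` finitely many finite-`h` rows imply nothing about `dWaveOrderParameter`.
The rows are those of the GRAND-CANONICAL sourced Hamiltonian at FIXED `μ`: a prescribed-filling
constraint is not a ground-state row of `A_L(h)` and is not covered. No certificate exists in this
file; these are soundness edges for certificates produced and checked elsewhere (card
`sourced-kkt-one-point-floor` of cell hubbard-cq, crux K2).

## References
* T. Koma, H. Tasaki, J. Stat. Phys. 76 (1994) 745, §1 (order parameter under a symmetry-breaking
  field). [cite: KomaTasaki1994, §1]
* J. Wang et al., Phys. Rev. X 14 (2024) 031006, §III, §VI (certified bounds on ground-state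
  observables; optimality constraints). [cite: WangEtAl2024, §III]
* M. Araújo et al., arXiv:2311.18707, §3.2 Prop. 11 (state optimality). [cite: AraujoEtAl2023, §3.2 Prop. 11]
-/

noncomputable section

namespace Literature.MathematicalPhysics.QuantumLattice

open Matrix Finset Literature.Probability.LatticeModels
  Literature.MathematicalPhysics.QuantumManyBody.StateRelaxation
open scoped ComplexOrder

variable (L : ℕ) [NeZero L]
variable {m : Type*} [Fintype m] [DecidableEq m]
variable {p : Type*} [Fintype p] [DecidableEq p]

/-! ### `t' = 0`: `dWaveSourceTorus` -/

section TpZero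

/-- **One-point certificate ⇒ sourced response floor** (`t' = 0`). For the pair-sourced torus
`A = dWaveSourceTorus L U μ h` (any `U, μ, h`, any side `L ≥ 1`), an identity
`(Δ_d + Δ_d†) − v·1 = gramForm Λ P + (Σₖ (A Xₖ − Xₖ A) + Σₗ (Wₗ Yₗ Wₗᴴ − Yₗ)) + (kktForm A G B + r)`
with `Λ, G ⪰ 0`, unitaries `Wₗ` commuting with `A`, arbitrary generators `B` and
`−ε ≤ Re ω₀(r)` certifies `v − ε ≤ 2L²·dWaveSourceDensity L U μ h`.
[cite: WangEtAl2024, §III] [cite: KomaTasaki1994, §1] -/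
theorem sq_mul_dWaveSourceDensity_ge_of_certificate_kkt (U μ h : ℝ)
    {Λ : Matrix m m ℂ} (hΛ : Λ.PosSemidef)
    (P : m → Matrix (Finset (Orb (FermionTorus 2 L))) (Finset (Orb (FermionTorus 2 L))) ℂ)
    {ι₁ : Type*} (s : Finset ι₁)
    (X : ι₁ → Matrix (Finset (Orb (FermionTorus 2 L))) (Finset (Orb (FermionTorus 2 L))) ℂ)
    {ι₂ : Type*} (t : Finset ι₂)
    (W Y : ι₂ → Matrix (Finset (Orb (FermionTorus 2 L))) (Finset (Orb (FermionTorus 2 L))) ℂ)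
    (hW : ∀ l ∈ t, W l * dWaveSourceTorus L U μ h = dWaveSourceTorus L U μ h * W l)
    (hWW : ∀ l ∈ t, (W l)ᴴ * W l = 1)
    {G : Matrix p p ℂ} (hG : G.PosSemidef)
    (B : p → Matrix (Finset (Orb (FermionTorus 2 L))) (Finset (Orb (FermionTorus 2 L))) ℂ)
    {r : Matrix (Finset (Orb (FermionTorus 2 L))) (Finset (Orb (FermionTorus 2 L))) ℂ} {ε : ℝ}
    (hr : -ε ≤ ((dWaveSourceTorus L U μ h).groundStateFunctional r).re) {v : ℝ}
    (hcert : (pairField dWaveFormFactor L + (pairField dWaveFormFactor L)ᴴ) - (v : ℂ) • 1 =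
      gramForm Λ P +
        (∑ b ∈ s, (dWaveSourceTorus L U μ h * X b - X b * dWaveSourceTorus L U μ h) +
          ∑ l ∈ t, (W l * Y l * (W l)ᴴ - Y l)) +
        (kktForm (dWaveSourceTorus L U μ h) G B + r)) :
    v - ε ≤ 2 * (L : ℝ) ^ 2 * dWaveSourceDensity L U μ h := by
  rw [← re_groundStateFunctional_dWaveSource_op]
  exact re_groundStateFunctional_ge_of_certificate_kkt
    (dWaveSourceTorus_isHermitian L (isHermitian_hubbardTorusWith L 1 U μ) h) hΛ P s X t W Y hW hWW
    hG B hr hcert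

/-- Per-site reading: the certificate of `sq_mul_dWaveSourceDensity_ge_of_certificate_kkt` gives the
response FLOOR `(v − ε)/(2L²) ≤ m_L(h)`. [cite: WangEtAl2024, §III] [cite: KomaTasaki1994, §1] -/
theorem dWaveSourceDensity_ge_of_certificate_kkt (U μ h : ℝ)
    {Λ : Matrix m m ℂ} (hΛ : Λ.PosSemidef)
    (P : m → Matrix (Finset (Orb (FermionTorus 2 L))) (Finset (Orb (FermionTorus 2 L))) ℂ)
    {ι₁ : Type*} (s : Finset ι₁)
    (X : ι₁ → Matrix (Finset (Orb (FermionTorus 2 L))) (Finset (Orb (FermionTorus 2 L))) ℂ)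
    {ι₂ : Type*} (t : Finset ι₂)
    (W Y : ι₂ → Matrix (Finset (Orb (FermionTorus 2 L))) (Finset (Orb (FermionTorus 2 L))) ℂ)
    (hW : ∀ l ∈ t, W l * dWaveSourceTorus L U μ h = dWaveSourceTorus L U μ h * W l)
    (hWW : ∀ l ∈ t, (W l)ᴴ * W l = 1)
    {G : Matrix p p ℂ} (hG : G.PosSemidef)
    (B : p → Matrix (Finset (Orb (FermionTorus 2 L))) (Finset (Orb (FermionTorus 2 L))) ℂ)
    {r : Matrix (Finset (Orb (FermionTorus 2 L))) (Finset (Orb (FermionTorus 2 L))) ℂ} {ε : ℝ}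
    (hr : -ε ≤ ((dWaveSourceTorus L U μ h).groundStateFunctional r).re) {v : ℝ}
    (hcert : (pairField dWaveFormFactor L + (pairField dWaveFormFactor L)ᴴ) - (v : ℂ) • 1 =
      gramForm Λ P +
        (∑ b ∈ s, (dWaveSourceTorus L U μ h * X b - X b * dWaveSourceTorus L U μ h) +
          ∑ l ∈ t, (W l * Y l * (W l)ᴴ - Y l)) +
        (kktForm (dWaveSourceTorus L U μ h) G B + r)) :
    (v - ε) / (2 * (L : ℝ) ^ 2) ≤ dWaveSourceDensity L U μ h := by
  have hL := cast_sq_pos_of_neZero L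
  rw [div_le_iff₀ (by positivity)]
  have h := sq_mul_dWaveSourceDensity_ge_of_certificate_kkt L U μ h hΛ P s X t W Y hW hWW hG B hr hcert
  linarith

/-- **Exact form** (`r = 0`): `v ≤ 2L²·m_L(h)`. [cite: WangEtAl2024, §III] [cite: KomaTasaki1994, §1] -/
theorem sq_mul_dWaveSourceDensity_ge_of_certificate_kkt_exact (U μ h : ℝ)
    {Λ : Matrix m m ℂ} (hΛ : Λ.PosSemidef)
    (P : m → Matrix (Finset (Orb (FermionTorus 2 L))) (Finset (Orb (FermionTorus 2 L))) ℂ)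
    {ι₁ : Type*} (s : Finset ι₁)
    (X : ι₁ → Matrix (Finset (Orb (FermionTorus 2 L))) (Finset (Orb (FermionTorus 2 L))) ℂ)
    {ι₂ : Type*} (t : Finset ι₂)
    (W Y : ι₂ → Matrix (Finset (Orb (FermionTorus 2 L))) (Finset (Orb (FermionTorus 2 L))) ℂ)
    (hW : ∀ l ∈ t, W l * dWaveSourceTorus L U μ h = dWaveSourceTorus L U μ h * W l)
    (hWW : ∀ l ∈ t, (W l)ᴴ * W l = 1)
    {G : Matrix p p ℂ} (hG : G.PosSemidef)
    (B : p → Matrix (Finset (Orb (FermionTorus 2 L))) (Finset (Orb (FermionTorus 2 L))) ℂ) {v : ℝ}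
    (hcert : (pairField dWaveFormFactor L + (pairField dWaveFormFactor L)ᴴ) - (v : ℂ) • 1 =
      gramForm Λ P +
        (∑ b ∈ s, (dWaveSourceTorus L U μ h * X b - X b * dWaveSourceTorus L U μ h) +
          ∑ l ∈ t, (W l * Y l * (W l)ᴴ - Y l)) +
        kktForm (dWaveSourceTorus L U μ h) G B) :
    v ≤ 2 * (L : ℝ) ^ 2 * dWaveSourceDensity L U μ h := by
  rw [← re_groundStateFunctional_dWaveSource_op]
  exact re_groundStateFunctional_ge_of_certificate_kkt_exact
    (dWaveSourceTorus_isHermitian L (isHermitian_hubbardTorusWith L 1 U μ) h) hΛ P s X t W Y hW hWW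
    hG B hcert

/-- **With energy-window rows**: the additional row element `κ₊(Ē·1 − A) + κ₋(A − E̲·1)`, `κ± ≥ 0`,
fed by certified bounds `E̲ ≤ E₀(A_L(h)) ≤ Ē` on the SOURCED ground-state energy (a sourced lower
certificate and a pinned variational upper bound). [cite: WangEtAl2024, §III] [cite: KomaTasaki1994, §1] -/
theorem sq_mul_dWaveSourceDensity_ge_of_certificate_kkt_window (U μ h : ℝ)
    {Λ : Matrix m m ℂ} (hΛ : Λ.PosSemidef)
    (P : m → Matrix (Finset (Orb (FermionTorus 2 L))) (Finset (Orb (FermionTorus 2 L))) ℂ)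
    {ι₁ : Type*} (s : Finset ι₁)
    (X : ι₁ → Matrix (Finset (Orb (FermionTorus 2 L))) (Finset (Orb (FermionTorus 2 L))) ℂ)
    {ι₂ : Type*} (t : Finset ι₂)
    (W Y : ι₂ → Matrix (Finset (Orb (FermionTorus 2 L))) (Finset (Orb (FermionTorus 2 L))) ℂ)
    (hW : ∀ l ∈ t, W l * dWaveSourceTorus L U μ h = dWaveSourceTorus L U μ h * W l)
    (hWW : ∀ l ∈ t, (W l)ᴴ * W l = 1)
    {G : Matrix p p ℂ} (hG : G.PosSemidef)
    (B : p → Matrix (Finset (Orb (FermionTorus 2 L))) (Finset (Orb (FermionTorus 2 L))) ℂ)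
    {κup κlo Eup Elo : ℝ} (hκup : 0 ≤ κup) (hκlo : 0 ≤ κlo)
    (hup : (dWaveSourceTorus L U μ h).groundEnergy ≤ Eup)
    (hlo : Elo ≤ (dWaveSourceTorus L U μ h).groundEnergy)
    {r : Matrix (Finset (Orb (FermionTorus 2 L))) (Finset (Orb (FermionTorus 2 L))) ℂ} {ε : ℝ}
    (hr : -ε ≤ ((dWaveSourceTorus L U μ h).groundStateFunctional r).re) {v : ℝ}
    (hcert : (pairField dWaveFormFactor L + (pairField dWaveFormFactor L)ᴴ) - (v : ℂ) • 1 =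
      gramForm Λ P +
        (∑ b ∈ s, (dWaveSourceTorus L U μ h * X b - X b * dWaveSourceTorus L U μ h) +
          ∑ l ∈ t, (W l * Y l * (W l)ᴴ - Y l)) +
        (kktForm (dWaveSourceTorus L U μ h) G B +
          ((κup : ℂ) • ((Eup : ℂ) • 1 - dWaveSourceTorus L U μ h) +
            (κlo : ℂ) • (dWaveSourceTorus L U μ h - (Elo : ℂ) • 1)) + r)) :
    v - ε ≤ 2 * (L : ℝ) ^ 2 * dWaveSourceDensity L U μ h := by
  rw [← re_groundStateFunctional_dWaveSource_op]
  exact re_groundStateFunctional_ge_of_certificate_kkt_window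
    (dWaveSourceTorus_isHermitian L (isHermitian_hubbardTorusWith L 1 U μ) h) hΛ P s X t W Y hW hWW
    hG B hκup hκlo hup hlo hr hcert

/-- **Ceiling edge** (`⟨O⟩_max`): `v·1 − (Δ_d + Δ_d†) = …` with the same rows certifies
`2L²·m_L(h) ≤ v + ε`. A ceiling; never speaks to presence. [cite: WangEtAl2024, §III]
[cite: KomaTasaki1994, §1] -/
theorem sq_mul_dWaveSourceDensity_le_of_certificate_kkt (U μ h : ℝ)
    {Λ : Matrix m m ℂ} (hΛ : Λ.PosSemidef)
    (P : m → Matrix (Finset (Orb (FermionTorus 2 L))) (Finset (Orb (FermionTorus 2 L))) ℂ)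
    {ι₁ : Type*} (s : Finset ι₁)
    (X : ι₁ → Matrix (Finset (Orb (FermionTorus 2 L))) (Finset (Orb (FermionTorus 2 L))) ℂ)
    {ι₂ : Type*} (t : Finset ι₂)
    (W Y : ι₂ → Matrix (Finset (Orb (FermionTorus 2 L))) (Finset (Orb (FermionTorus 2 L))) ℂ)
    (hW : ∀ l ∈ t, W l * dWaveSourceTorus L U μ h = dWaveSourceTorus L U μ h * W l)
    (hWW : ∀ l ∈ t, (W l)ᴴ * W l = 1)
    {G : Matrix p p ℂ} (hG : G.PosSemidef)
    (B : p → Matrix (Finset (Orb (FermionTorus 2 L))) (Finset (Orb (FermionTorus 2 L))) ℂ)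
    {r : Matrix (Finset (Orb (FermionTorus 2 L))) (Finset (Orb (FermionTorus 2 L))) ℂ} {ε : ℝ}
    (hr : -ε ≤ ((dWaveSourceTorus L U μ h).groundStateFunctional r).re) {v : ℝ}
    (hcert : (v : ℂ) • 1 - (pairField dWaveFormFactor L + (pairField dWaveFormFactor L)ᴴ) =
      gramForm Λ P +
        (∑ b ∈ s, (dWaveSourceTorus L U μ h * X b - X b * dWaveSourceTorus L U μ h) +
          ∑ l ∈ t, (W l * Y l * (W l)ᴴ - Y l)) +
        (kktForm (dWaveSourceTorus L U μ h) G B + r)) :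
    2 * (L : ℝ) ^ 2 * dWaveSourceDensity L U μ h ≤ v + ε := by
  rw [← re_groundStateFunctional_dWaveSource_op]
  exact re_groundStateFunctional_le_of_certificate_kkt
    (dWaveSourceTorus_isHermitian L (isHermitian_hubbardTorusWith L 1 U μ) h) hΛ P s X t W Y hW hWW
    hG B hr hcert

end TpZero

/-! ### `t–t'`: `dWaveSourceTorusTT'` -/

section TTPrime

/-- **One-point certificate ⇒ sourced response floor, `t–t'` torus.** For
`A = dWaveSourceTorusTT' L t' U μ h` (any `t', U, μ, h`), an identity
`(Δ_d + Δ_d†) − v·1 = gramForm Λ P + (Σₖ (A Xₖ − Xₖ A) + Σₗ (Wₗ Yₗ Wₗᴴ − Yₗ)) + (kktForm A G B + r)`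
with `Λ, G ⪰ 0`, unitaries `Wₗ` commuting with `A`, arbitrary generators `B` and `−ε ≤ Re ω₀(r)`
certifies `v − ε ≤ 2L²·dWaveSourceDensityTT' L t' U μ h`. [cite: WangEtAl2024, §III]
[cite: KomaTasaki1994, §1] -/
theorem sq_mul_dWaveSourceDensityTT'_ge_of_certificate_kkt (t' U μ h : ℝ)
    {Λ : Matrix m m ℂ} (hΛ : Λ.PosSemidef)
    (P : m → Matrix (Finset (Orb (FermionTorus 2 L))) (Finset (Orb (FermionTorus 2 L))) ℂ)
    {ι₁ : Type*} (s : Finset ι₁)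
    (X : ι₁ → Matrix (Finset (Orb (FermionTorus 2 L))) (Finset (Orb (FermionTorus 2 L))) ℂ)
    {ι₂ : Type*} (t : Finset ι₂)
    (W Y : ι₂ → Matrix (Finset (Orb (FermionTorus 2 L))) (Finset (Orb (FermionTorus 2 L))) ℂ)
    (hW : ∀ l ∈ t, W l * dWaveSourceTorusTT' L t' U μ h = dWaveSourceTorusTT' L t' U μ h * W l)
    (hWW : ∀ l ∈ t, (W l)ᴴ * W l = 1)
    {G : Matrix p p ℂ} (hG : G.PosSemidef)
    (B : p → Matrix (Finset (Orb (FermionTorus 2 L))) (Finset (Orb (FermionTorus 2 L))) ℂ)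
    {r : Matrix (Finset (Orb (FermionTorus 2 L))) (Finset (Orb (FermionTorus 2 L))) ℂ} {ε : ℝ}
    (hr : -ε ≤ ((dWaveSourceTorusTT' L t' U μ h).groundStateFunctional r).re) {v : ℝ}
    (hcert : (pairField dWaveFormFactor L + (pairField dWaveFormFactor L)ᴴ) - (v : ℂ) • 1 =
      gramForm Λ P +
        (∑ b ∈ s, (dWaveSourceTorusTT' L t' U μ h * X b - X b * dWaveSourceTorusTT' L t' U μ h) +
          ∑ l ∈ t, (W l * Y l * (W l)ᴴ - Y l)) +
        (kktForm (dWaveSourceTorusTT' L t' U μ h) G B + r)) :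
    v - ε ≤ 2 * (L : ℝ) ^ 2 * dWaveSourceDensityTT' L t' U μ h := by
  rw [← re_groundStateFunctional_dWaveSourceTT'_op]
  exact re_groundStateFunctional_ge_of_certificate_kkt (dWaveSourceTorusTT'_isHermitian L t' U μ h)
    hΛ P s X t W Y hW hWW hG B hr hcert

/-- Per-site reading, `t–t'`: `(v − ε)/(2L²) ≤ dWaveSourceDensityTT' L t' U μ h` — a
`PinFieldTorusResponseFloor`-shaped row of the hubbard-obs pinning-field menu once `v, ε` are
rational literals. [cite: WangEtAl2024, §III] [cite: KomaTasaki1994, §1] -/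
theorem dWaveSourceDensityTT'_ge_of_certificate_kkt (t' U μ h : ℝ)
    {Λ : Matrix m m ℂ} (hΛ : Λ.PosSemidef)
    (P : m → Matrix (Finset (Orb (FermionTorus 2 L))) (Finset (Orb (FermionTorus 2 L))) ℂ)
    {ι₁ : Type*} (s : Finset ι₁)
    (X : ι₁ → Matrix (Finset (Orb (FermionTorus 2 L))) (Finset (Orb (FermionTorus 2 L))) ℂ)
    {ι₂ : Type*} (t : Finset ι₂)
    (W Y : ι₂ → Matrix (Finset (Orb (FermionTorus 2 L))) (Finset (Orb (FermionTorus 2 L))) ℂ)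
    (hW : ∀ l ∈ t, W l * dWaveSourceTorusTT' L t' U μ h = dWaveSourceTorusTT' L t' U μ h * W l)
    (hWW : ∀ l ∈ t, (W l)ᴴ * W l = 1)
    {G : Matrix p p ℂ} (hG : G.PosSemidef)
    (B : p → Matrix (Finset (Orb (FermionTorus 2 L))) (Finset (Orb (FermionTorus 2 L))) ℂ)
    {r : Matrix (Finset (Orb (FermionTorus 2 L))) (Finset (Orb (FermionTorus 2 L))) ℂ} {ε : ℝ}
    (hr : -ε ≤ ((dWaveSourceTorusTT' L t' U μ h).groundStateFunctional r).re) {v : ℝ}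
    (hcert : (pairField dWaveFormFactor L + (pairField dWaveFormFactor L)ᴴ) - (v : ℂ) • 1 =
      gramForm Λ P +
        (∑ b ∈ s, (dWaveSourceTorusTT' L t' U μ h * X b - X b * dWaveSourceTorusTT' L t' U μ h) +
          ∑ l ∈ t, (W l * Y l * (W l)ᴴ - Y l)) +
        (kktForm (dWaveSourceTorusTT' L t' U μ h) G B + r)) :
    (v - ε) / (2 * (L : ℝ) ^ 2) ≤ dWaveSourceDensityTT' L t' U μ h := by
  have hL := cast_sq_pos_of_neZero L
  rw [div_le_iff₀ (by positivity)]
  have h := sq_mul_dWaveSourceDensityTT'_ge_of_certificate_kkt L t' U μ h hΛ P s X t W Y hW hWW hG B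
    hr hcert
  linarith

/-- **Exact form, `t–t'`** (`r = 0`): `v ≤ 2L²·dWaveSourceDensityTT' L t' U μ h`.
[cite: WangEtAl2024, §III] [cite: KomaTasaki1994, §1] -/
theorem sq_mul_dWaveSourceDensityTT'_ge_of_certificate_kkt_exact (t' U μ h : ℝ)
    {Λ : Matrix m m ℂ} (hΛ : Λ.PosSemidef)
    (P : m → Matrix (Finset (Orb (FermionTorus 2 L))) (Finset (Orb (FermionTorus 2 L))) ℂ)
    {ι₁ : Type*} (s : Finset ι₁)
    (X : ι₁ → Matrix (Finset (Orb (FermionTorus 2 L))) (Finset (Orb (FermionTorus 2 L))) ℂ)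
    {ι₂ : Type*} (t : Finset ι₂)
    (W Y : ι₂ → Matrix (Finset (Orb (FermionTorus 2 L))) (Finset (Orb (FermionTorus 2 L))) ℂ)
    (hW : ∀ l ∈ t, W l * dWaveSourceTorusTT' L t' U μ h = dWaveSourceTorusTT' L t' U μ h * W l)
    (hWW : ∀ l ∈ t, (W l)ᴴ * W l = 1)
    {G : Matrix p p ℂ} (hG : G.PosSemidef)
    (B : p → Matrix (Finset (Orb (FermionTorus 2 L))) (Finset (Orb (FermionTorus 2 L))) ℂ) {v : ℝ}
    (hcert : (pairField dWaveFormFactor L + (pairField dWaveFormFactor L)ᴴ) - (v : ℂ) • 1 =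
      gramForm Λ P +
        (∑ b ∈ s, (dWaveSourceTorusTT' L t' U μ h * X b - X b * dWaveSourceTorusTT' L t' U μ h) +
          ∑ l ∈ t, (W l * Y l * (W l)ᴴ - Y l)) +
        kktForm (dWaveSourceTorusTT' L t' U μ h) G B) :
    v ≤ 2 * (L : ℝ) ^ 2 * dWaveSourceDensityTT' L t' U μ h := by
  rw [← re_groundStateFunctional_dWaveSourceTT'_op]
  exact re_groundStateFunctional_ge_of_certificate_kkt_exact (dWaveSourceTorusTT'_isHermitian L t' U μ h)
    hΛ P s X t W Y hW hWW hG B hcert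

/-- **With energy-window rows, `t–t'`**: `κ₊(Ē·1 − A) + κ₋(A − E̲·1)`, `κ± ≥ 0`, fed by certified
`E̲ ≤ E₀(A) ≤ Ē` for `A = dWaveSourceTorusTT' L t' U μ h`. [cite: WangEtAl2024, §III] [cite: KomaTasaki1994, §1] -/
theorem sq_mul_dWaveSourceDensityTT'_ge_of_certificate_kkt_window (t' U μ h : ℝ)
    {Λ : Matrix m m ℂ} (hΛ : Λ.PosSemidef)
    (P : m → Matrix (Finset (Orb (FermionTorus 2 L))) (Finset (Orb (FermionTorus 2 L))) ℂ)
    {ι₁ : Type*} (s : Finset ι₁)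
    (X : ι₁ → Matrix (Finset (Orb (FermionTorus 2 L))) (Finset (Orb (FermionTorus 2 L))) ℂ)
    {ι₂ : Type*} (t : Finset ι₂)
    (W Y : ι₂ → Matrix (Finset (Orb (FermionTorus 2 L))) (Finset (Orb (FermionTorus 2 L))) ℂ)
    (hW : ∀ l ∈ t, W l * dWaveSourceTorusTT' L t' U μ h = dWaveSourceTorusTT' L t' U μ h * W l)
    (hWW : ∀ l ∈ t, (W l)ᴴ * W l = 1)
    {G : Matrix p p ℂ} (hG : G.PosSemidef)
    (B : p → Matrix (Finset (Orb (FermionTorus 2 L))) (Finset (Orb (FermionTorus 2 L))) ℂ)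
    {κup κlo Eup Elo : ℝ} (hκup : 0 ≤ κup) (hκlo : 0 ≤ κlo)
    (hup : (dWaveSourceTorusTT' L t' U μ h).groundEnergy ≤ Eup)
    (hlo : Elo ≤ (dWaveSourceTorusTT' L t' U μ h).groundEnergy)
    {r : Matrix (Finset (Orb (FermionTorus 2 L))) (Finset (Orb (FermionTorus 2 L))) ℂ} {ε : ℝ}
    (hr : -ε ≤ ((dWaveSourceTorusTT' L t' U μ h).groundStateFunctional r).re) {v : ℝ}
    (hcert : (pairField dWaveFormFactor L + (pairField dWaveFormFactor L)ᴴ) - (v : ℂ) • 1 =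
      gramForm Λ P +
        (∑ b ∈ s, (dWaveSourceTorusTT' L t' U μ h * X b - X b * dWaveSourceTorusTT' L t' U μ h) +
          ∑ l ∈ t, (W l * Y l * (W l)ᴴ - Y l)) +
        (kktForm (dWaveSourceTorusTT' L t' U μ h) G B +
          ((κup : ℂ) • ((Eup : ℂ) • 1 - dWaveSourceTorusTT' L t' U μ h) +
            (κlo : ℂ) • (dWaveSourceTorusTT' L t' U μ h - (Elo : ℂ) • 1)) + r)) :
    v - ε ≤ 2 * (L : ℝ) ^ 2 * dWaveSourceDensityTT' L t' U μ h := by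
  rw [← re_groundStateFunctional_dWaveSourceTT'_op]
  exact re_groundStateFunctional_ge_of_certificate_kkt_window (dWaveSourceTorusTT'_isHermitian L t' U μ h)
    hΛ P s X t W Y hW hWW hG B hκup hκlo hup hlo hr hcert

/-- **Ceiling edge, `t–t'`** (`⟨O⟩_max`): `v·1 − (Δ_d + Δ_d†) = …` certifies
`2L²·dWaveSourceDensityTT' L t' U μ h ≤ v + ε`. A ceiling; never speaks to presence.
[cite: WangEtAl2024, §III] [cite: KomaTasaki1994, §1] -/
theorem sq_mul_dWaveSourceDensityTT'_le_of_certificate_kkt (t' U μ h : ℝ)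
    {Λ : Matrix m m ℂ} (hΛ : Λ.PosSemidef)
    (P : m → Matrix (Finset (Orb (FermionTorus 2 L))) (Finset (Orb (FermionTorus 2 L))) ℂ)
    {ι₁ : Type*} (s : Finset ι₁)
    (X : ι₁ → Matrix (Finset (Orb (FermionTorus 2 L))) (Finset (Orb (FermionTorus 2 L))) ℂ)
    {ι₂ : Type*} (t : Finset ι₂)
    (W Y : ι₂ → Matrix (Finset (Orb (FermionTorus 2 L))) (Finset (Orb (FermionTorus 2 L))) ℂ)
    (hW : ∀ l ∈ t, W l * dWaveSourceTorusTT' L t' U μ h = dWaveSourceTorusTT' L t' U μ h * W l)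
    (hWW : ∀ l ∈ t, (W l)ᴴ * W l = 1)
    {G : Matrix p p ℂ} (hG : G.PosSemidef)
    (B : p → Matrix (Finset (Orb (FermionTorus 2 L))) (Finset (Orb (FermionTorus 2 L))) ℂ)
    {r : Matrix (Finset (Orb (FermionTorus 2 L))) (Finset (Orb (FermionTorus 2 L))) ℂ} {ε : ℝ}
    (hr : -ε ≤ ((dWaveSourceTorusTT' L t' U μ h).groundStateFunctional r).re) {v : ℝ}
    (hcert : (v : ℂ) • 1 - (pairField dWaveFormFactor L + (pairField dWaveFormFactor L)ᴴ) =
      gramForm Λ P +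
        (∑ b ∈ s, (dWaveSourceTorusTT' L t' U μ h * X b - X b * dWaveSourceTorusTT' L t' U μ h) +
          ∑ l ∈ t, (W l * Y l * (W l)ᴴ - Y l)) +
        (kktForm (dWaveSourceTorusTT' L t' U μ h) G B + r)) :
    2 * (L : ℝ) ^ 2 * dWaveSourceDensityTT' L t' U μ h ≤ v + ε := by
  rw [← re_groundStateFunctional_dWaveSourceTT'_op]
  exact re_groundStateFunctional_le_of_certificate_kkt (dWaveSourceTorusTT'_isHermitian L t' U μ h)
    hΛ P s X t W Y hW hWW hG B hr hcert

/-- **Every ground state, `t–t'`**: the same certificate bounds the one-point response of EVERY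
ground-state density matrix `ρ` of `A = dWaveSourceTorusTT' L t' U μ h` (pure or mixed) that commutes
with the symmetry unitaries used (`Wₗ ρ = ρ Wₗ`; with `t = ∅`, every ground state):
`v − ε ≤ Re tr(ρ (Δ_d + Δ_d†))`. The tracial state behind `dWaveSourceDensityTT'` is one of them
(`isGroundStateDensityMatrix_tracialState`). [cite: ScheerEtAl2025, §II eq. (2)]
[cite: KomaTasaki1994, §1] -/
theorem re_trace_dWaveSourceTT'_op_ge_of_certificate_kkt (t' U μ h : ℝ)
    {ρ : Matrix (Finset (Orb (FermionTorus 2 L))) (Finset (Orb (FermionTorus 2 L))) ℂ}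
    (hρ : Literature.Barriers.HubbardSuperconductivity.IsGroundStateDensityMatrix
      (dWaveSourceTorusTT' L t' U μ h) ρ)
    {Λ : Matrix m m ℂ} (hΛ : Λ.PosSemidef)
    (P : m → Matrix (Finset (Orb (FermionTorus 2 L))) (Finset (Orb (FermionTorus 2 L))) ℂ)
    {ι₁ : Type*} (s : Finset ι₁)
    (X : ι₁ → Matrix (Finset (Orb (FermionTorus 2 L))) (Finset (Orb (FermionTorus 2 L))) ℂ)
    {ι₂ : Type*} (t : Finset ι₂)
    (W Y : ι₂ → Matrix (Finset (Orb (FermionTorus 2 L))) (Finset (Orb (FermionTorus 2 L))) ℂ)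
    (hWW : ∀ l ∈ t, (W l)ᴴ * W l = 1) (hWρ : ∀ l ∈ t, W l * ρ = ρ * W l)
    {G : Matrix p p ℂ} (hG : G.PosSemidef)
    (B : p → Matrix (Finset (Orb (FermionTorus 2 L))) (Finset (Orb (FermionTorus 2 L))) ℂ)
    {r : Matrix (Finset (Orb (FermionTorus 2 L))) (Finset (Orb (FermionTorus 2 L))) ℂ} {ε : ℝ}
    (hr : -ε ≤ (ρ * r).trace.re) {v : ℝ}
    (hcert : (pairField dWaveFormFactor L + (pairField dWaveFormFactor L)ᴴ) - (v : ℂ) • 1 =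
      gramForm Λ P +
        (∑ b ∈ s, (dWaveSourceTorusTT' L t' U μ h * X b - X b * dWaveSourceTorusTT' L t' U μ h) +
          ∑ l ∈ t, (W l * Y l * (W l)ᴴ - Y l)) +
        (kktForm (dWaveSourceTorusTT' L t' U μ h) G B + r)) :
    v - ε ≤ (ρ * (pairField dWaveFormFactor L + (pairField dWaveFormFactor L)ᴴ)).trace.re :=
  re_trace_mul_ge_of_certificate_kkt_of_isGroundStateDensityMatrix
    (dWaveSourceTorusTT'_isHermitian L t' U μ h) hρ hΛ P s X t W Y hWW hWρ hG B hr hcert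

end TTPrime

end Literature.MathematicalPhysics.QuantumLattice
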